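import Mathlib
import HarnessLib
import Summits.HubbardSuperconductivity.HubbardSuperconductivity.Theorems.KLProgrammeKLRegimeTorusL1ThirdDifferencesMoment
import Summits.HubbardSuperconductivity.HubbardSuperconductivity.Theorems.KLProgrammeKLRegimeTorusL1DyadicSuperposition

/-!
# Route `KLProgramme` — engine support (rows E-b2(4)/E-b3 of the (b) closing path, NORM side, brick (T1w)): the ONE-POSITION-MOMENT weighted `ℓ¹` norm
# of a space-time character sum whose symbol is a SUPERPOSITION OF SCALE BUMPS is paid by the `ℓ¹` sum of the coefficients — weighted twin of
# `…TorusL1DyadicSuperposition` (model-free torus harmonic analysis)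

Cell `gate-hubbard-kl`, seat hubbard-kl-k3c2-p3 (g17; row «sector-counting import»), for the ENGINE crux stmt-HubbardSuperconductivity-20437
(`KLRegimeEngineV17F2`): after (R416) the E1 docket's FOUR-leg items on the (b) path are the weighted cell E-b2(4) (`klScaleWt_j`-weighted PLAIN four-leg line of
`𝒱_j[K_n]`) and E-b3 (`WtTupleLineAt`); the un-weighted (X).1 chain reads a momentum-space representation (pair-transfer bumps + total variation,
g16 (T1)–(T9)).  The weighted rows read the SAME representation once the bump lemma carries one position moment: a bump of rates `(s₀, s₁)` has its
Fourier transform concentrated on `|z₀| ≲ 1/s₀`, `|z⃗| ≲ 1/s₁`, so the moment weight AT THE BUMP'S OWN RATES costs `O(1)` — and the tree weight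
`klScaleWt_j = 1 + Λ_j·d` of a level `j` COARSER than the bump (`Λ_j`-rates below the bump's) is below that moment weight.  This file is the axis-frame,
scale-free packaging of p3's first-moment master lemma `sum_wt_norm_charSum_le_of_third_differences` (third differences; order two does not carry a moment):

* §1 `momentWt_mono` — the moment weight `1 + t₀|z̃₁| + t₁|z̃₂,₁| + t₁|z̃₂,₂|` is monotone in the rates;
* §2 **`sum_wt_norm_charSum_le_of_third_differences_axes`** — frame `v = (1,0)`, near radius `0`, one space rate: if `‖G‖ ≤ A₀`, `#{G ≠ 0} ≤ N_s`,
  `‖Δ³_{(1,0)}G‖ ≤ A₀(4/(s₀P))³`, `‖Δ³_{(0,eᵢ)}G‖ ≤ A₀(4/(s₁L))³`, then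
  `Σ_z (1 + s₀|z̃₁| + s₁|z̃₂,₁| + s₁|z̃₂,₂|)·‖Σ_q χ_{q₁}(z₁)χ_{q₂}(z₂)•G(q)‖ ≤ √(32768(1/s₀+1)((1+4√2)²·4(2√2/s₁+2)² + 16(1/s₁+1)²))·√(21PL²N_s)·A₀`;
* §3 `rate_bookkeeping_wt_le`, **`sum_wt_norm_charSum_bump_le`** — SCALE-FREE form: rates `s₀, s₁ ∈ (0,1]`, support `N_s ≤ n₀(s₀P)(s₁L)²`, weight rates
  `0 ≤ t₀ ≤ s₀`, `0 ≤ t₁ ≤ s₁`: `Σ_z (1 + t₀|z̃₁| + t₁|z̃₂,₁| + t₁|z̃₂,₂|)·‖S[G](z)‖ ≤ √(6561988608·n₀)·(P·L²)·A₀`;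
* §4 `sum_wt_norm_charSum_sum_mul_le`, **`sum_wt_norm_charSum_superposition_le`** — for a finite family of bumps `G_s` (rates `≥ (t₀, t₁)` componentwise, `≤ 1`,
  sizes `A_s`, supports `≤ n₀ s₀ˢP(s₁ˢL)²`) and coefficients `a_s`: `Σ_z w_t(z)·‖S[Σ_s a_s G_s](z)‖ ≤ √(6561988608·n₀)·(P·L²)·Σ_s ‖a_s‖·A_s`.
Everything is proved; no definitions, no named facts; nothing here asserts any engine row, K3 or superconductivity. [folklore]
References: BGM 2006 Lemma 2.2 (2.52), §2.8 (2.81) footnote ¹ [cite: BenfattoGiulianiMastropietro2006]; Katznelson, *Harmonic Analysis*, Ch. I §6.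
-/

noncomputable section

namespace Summit.HubbardSuperconductivity.HubbardSuperconductivity.Theorems.TorusFourierL2

set_option linter.dupNamespace false -- summit = problem name (single-conjunct summit), D-0017

open Finset Complex Literature.Probability.LatticeModels
open scoped Real

variable {P L : ℕ} [NeZero P] [NeZero L]

/-! ### §1 The moment weight is monotone in the rates -/

omit [NeZero P] [NeZero L] in
/-- The one-moment weight `1 + t₀|z̃₁| + t₁|z̃₂,₁| + t₁|z̃₂,₂|` is monotone in the rates `(t₀, t₁)`. [folklore] -/
theorem momentWt_mono {t₀ t₁ s₀ s₁ : ℝ} (h₀ : t₀ ≤ s₀) (h₁ : t₁ ≤ s₁) (z : TorusSite 1 P × TorusSite 2 L) :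
    1 + t₀ * |(((z.1 0).valMinAbs : ℤ) : ℝ)| + t₁ * |(((z.2 0).valMinAbs : ℤ) : ℝ)| + t₁ * |(((z.2 1).valMinAbs : ℤ) : ℝ)| ≤
      1 + s₀ * |(((z.1 0).valMinAbs : ℤ) : ℝ)| + s₁ * |(((z.2 0).valMinAbs : ℤ) : ℝ)| + s₁ * |(((z.2 1).valMinAbs : ℤ) : ℝ)| := by
  have ha := abs_nonneg (((z.1 0).valMinAbs : ℤ) : ℝ)
  have hb := abs_nonneg (((z.2 0).valMinAbs : ℤ) : ℝ)
  have hc := abs_nonneg (((z.2 1).valMinAbs : ℤ) : ℝ)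
  nlinarith [mul_le_mul_of_nonneg_right h₀ ha, mul_le_mul_of_nonneg_right h₁ hb, mul_le_mul_of_nonneg_right h₁ hc]

/-! ### §2 The axis-frame instance of the first-moment master lemma -/

/-- **The one-moment weighted `ℓ¹` norm of a space-time character sum from sup, support and the THIRD differences along the time axis and the two
space axes** (frame `v = (1,0)`, near radius `0`):
`Σ_z (1 + s₀|z̃₁| + s₁|z̃₂,₁| + s₁|z̃₂,₂|)·‖Σ_q χ_{q₁}(z₁)χ_{q₂}(z₂)•G(q)‖ ≤ √(32768(1/s₀+1)((1+4√2)²·(4(2√2/s₁+2)²) + 16(1/s₁+1)²))·√(21PL²N_s)·A₀`.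
[cite: BenfattoGiulianiMastropietro2006, Lemma 2.2 (2.52), §2.8 (2.81) footnote 1] -/
theorem sum_wt_norm_charSum_le_of_third_differences_axes (G : TorusSite 1 P × TorusSite 2 L → ℂ)
    {s₀ s₁ : ℝ} (hs₀ : 0 < s₀) (hs₁ : 0 < s₁) {A₀ : ℝ} (hA₀ : 0 ≤ A₀) {Ns : ℕ}
    (hsupp : (univ.filter fun q => G q ≠ 0).card ≤ Ns) (hsup : ∀ q, ‖G q‖ ≤ A₀)
    (h₀ : ∀ q, ‖(fwdDiff ((fun _ : Fin 1 => (1 : ZMod P)), (0 : TorusSite 2 L)))^[3] G q‖ ≤ A₀ * (4 / (s₀ * P)) ^ 3)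
    (h₁ : ∀ q (i : Fin 2), ‖(fwdDiff ((0 : TorusSite 1 P), (Pi.single i (1 : ZMod L) : TorusSite 2 L)))^[3] G q‖ ≤
      A₀ * (4 / (s₁ * L)) ^ 3) :
    ∑ z : TorusSite 1 P × TorusSite 2 L,
      (1 + s₀ * |(((z.1 0).valMinAbs : ℤ) : ℝ)| + s₁ * |(((z.2 0).valMinAbs : ℤ) : ℝ)| + s₁ * |(((z.2 1).valMinAbs : ℤ) : ℝ)|) *
        ‖∑ q : TorusSite 1 P × TorusSite 2 L, (torusChar q.1 z.1 * torusChar q.2 z.2) • G q‖ ≤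
      Real.sqrt (32768 * (1 / s₀ + 1) *
          ((1 + 4 * Real.sqrt 2) ^ 2 * (4 * (2 * Real.sqrt 2 / s₁ + 2) ^ 2) + 16 * (1 / s₁ + 1) ^ 2)) *
        Real.sqrt (21 * P * (L : ℝ) ^ 2 * Ns) * A₀ := by
  have hL : (0 : ℤ) < (L : ℤ) := by exact_mod_cast Nat.pos_of_ne_zero (NeZero.ne L)
  -- the frame `v = (1, 0)`: `v⊥ = (0, 1)`, both axis directions again
  have hv : (![(1 : ℤ), 0] : Fin 2 → ℤ) ≠ 0 := by
    intro h; have := congr_fun h 0; simp at this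
  have hR₀ : 2 * (|(![(1 : ℤ), 0] : Fin 2 → ℤ) 0| + |(![(1 : ℤ), 0] : Fin 2 → ℤ) 1|) * ((0 : ℕ) : ℤ) < L := by simpa using hL
  have hd2 : ((0 : TorusSite 1 P), (fun j : Fin 2 => ((![-(![(1 : ℤ), 0] : Fin 2 → ℤ) 1, (![(1 : ℤ), 0] : Fin 2 → ℤ) 0] j : ℤ) : ZMod L))) =
      ((0 : TorusSite 1 P), (Pi.single 1 (1 : ZMod L) : TorusSite 2 L)) := by
    refine Prod.ext rfl (funext fun j => ?_)
    fin_cases j <;> simp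
  have hd3 : ((0 : TorusSite 1 P), (fun j : Fin 2 => (((![(1 : ℤ), 0] : Fin 2 → ℤ) j : ℤ) : ZMod L))) =
      ((0 : TorusSite 1 P), (Pi.single 0 (1 : ZMod L) : TorusSite 2 L)) := by
    refine Prod.ext rfl (funext fun j => ?_)
    fin_cases j <;> simp
  have h₂ : ∀ q, ‖(fwdDiff ((0 : TorusSite 1 P), (fun j : Fin 2 => ((![-(![(1 : ℤ), 0] : Fin 2 → ℤ) 1, (![(1 : ℤ), 0] : Fin 2 → ℤ) 0] j : ℤ) : ZMod L))))^[3]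
      G q‖ ≤ A₀ * (4 / (s₁ * L)) ^ 3 := fun q => by rw [hd2]; exact h₁ q 1
  have h₃ : ∀ q, ‖(fwdDiff ((0 : TorusSite 1 P), (fun j : Fin 2 => (((![(1 : ℤ), 0] : Fin 2 → ℤ) j : ℤ) : ZMod L))))^[3] G q‖ ≤
      A₀ * (4 / (s₁ * L)) ^ 3 := fun q => by rw [hd3]; exact h₁ q 0
  have hmain := sum_wt_norm_charSum_le_of_third_differences G (![(1 : ℤ), 0]) hv hs₀ hs₁ hs₁ hs₁ (R₀ := 0) hR₀ hA₀ hsupp hsup h₀ h₁ h₂ h₃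
  refine hmain.trans (le_of_eq ?_)
  -- evaluate the frame-dependent constant at `v = (1,0)`, `s₂ = s₃ = s₁`, `R₀ = 0`
  have hnorm : Real.sqrt ((((![(1 : ℤ), 0] : Fin 2 → ℤ) 0 : ℤ) : ℝ) ^ 2 + ((((![(1 : ℤ), 0] : Fin 2 → ℤ) 1 : ℤ) : ℝ)) ^ 2) = 1 := by simp
  have hs₁ne : s₁ ≠ 0 := hs₁.ne'
  congr 1
  congr 1
  congr 1
  rw [hnorm]
  have hcw : 1 + 2 * Real.sqrt 2 * s₁ / (s₁ * 1) + 2 * Real.sqrt 2 * s₁ / (s₁ * 1) = 1 + 4 * Real.sqrt 2 := by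
    field_simp; ring
  have hprod : 4 * ((2 * Real.sqrt 2 / (s₁ * 1) + 2) * (2 * Real.sqrt 2 / (s₁ * 1) + 2)) = 4 * (2 * Real.sqrt 2 / s₁ + 2) ^ 2 := by
    rw [mul_one]; ring
  rw [hcw, hprod, Nat.cast_zero, mul_zero, add_zero, div_one]

/-! ### §3 The scale-free bump form -/

/-- `(1 + 4√2)² ≤ 49`. [folklore] -/
theorem one_add_four_sqrt_two_sq_le : (1 + 4 * Real.sqrt 2) ^ 2 ≤ 49 := by
  have hs : Real.sqrt 2 ≤ 3 / 2 := by
    rw [show (3 / 2 : ℝ) = Real.sqrt ((3 / 2) ^ 2) by rw [Real.sqrt_sq (by norm_num)]]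
    exact Real.sqrt_le_sqrt (by norm_num)
  nlinarith [Real.sqrt_nonneg 2]

omit [NeZero P] [NeZero L] in
/-- The rate bookkeeping (weighted): for `0 < s₀, s₁ ≤ 1` and `N_s ≤ n₀·(s₀P)(s₁L)²`,
`32768(1/s₀+1)((1+4√2)²·4(2√2/s₁+2)² + 16(1/s₁+1)²) · (21·P·L²·N_s) ≤ 6561988608·n₀·(P·L²)²`. [folklore] -/
theorem rate_bookkeeping_wt_le {s₀ s₁ : ℝ} (hs₀ : 0 < s₀) (hs₀1 : s₀ ≤ 1) (hs₁ : 0 < s₁) (hs₁1 : s₁ ≤ 1)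
    {n₀ : ℝ} {Ns : ℕ} (hNs : (Ns : ℝ) ≤ n₀ * (s₀ * P) * (s₁ * L) ^ 2) :
    32768 * (1 / s₀ + 1) * ((1 + 4 * Real.sqrt 2) ^ 2 * (4 * (2 * Real.sqrt 2 / s₁ + 2) ^ 2) + 16 * (1 / s₁ + 1) ^ 2) *
        (21 * P * (L : ℝ) ^ 2 * Ns) ≤
      6561988608 * n₀ * ((P : ℝ) * (L : ℝ) ^ 2) ^ 2 := by
  have hP : (0 : ℝ) ≤ P := Nat.cast_nonneg _
  have hL : (0 : ℝ) ≤ L := Nat.cast_nonneg _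
  have ha : 1 / s₀ + 1 ≤ 2 / s₀ := by
    rw [div_add_one (ne_of_gt hs₀), div_le_div_iff_of_pos_right hs₀]; linarith
  have hb : 2 * Real.sqrt 2 / s₁ + 2 ≤ (2 * Real.sqrt 2 + 2) / s₁ := by
    rw [add_div, add_le_add_iff_left, le_div_iff₀ hs₁]; nlinarith
  have hb0 : 0 ≤ 2 * Real.sqrt 2 / s₁ + 2 := by positivity
  have hb2 : (2 * Real.sqrt 2 / s₁ + 2) ^ 2 ≤ 24 / s₁ ^ 2 := by
    calc (2 * Real.sqrt 2 / s₁ + 2) ^ 2 ≤ ((2 * Real.sqrt 2 + 2) / s₁) ^ 2 := pow_le_pow_left₀ hb0 hb 2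
      _ = (2 * Real.sqrt 2 + 2) ^ 2 / s₁ ^ 2 := by rw [div_pow]
      _ ≤ 24 / s₁ ^ 2 := div_le_div_of_nonneg_right two_sqrt_two_add_two_sq_le (by positivity)
  have hc : 1 / s₁ + 1 ≤ 2 / s₁ := by
    rw [div_add_one (ne_of_gt hs₁), div_le_div_iff_of_pos_right hs₁]; linarith
  have hc0 : 0 ≤ 1 / s₁ + 1 := by positivity
  have hc2 : (1 / s₁ + 1) ^ 2 ≤ 4 / s₁ ^ 2 := by
    calc (1 / s₁ + 1) ^ 2 ≤ (2 / s₁) ^ 2 := pow_le_pow_left₀ hc0 hc 2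
      _ = 4 / s₁ ^ 2 := by rw [div_pow]; norm_num
  have hK : 32768 * (1 / s₀ + 1) * ((1 + 4 * Real.sqrt 2) ^ 2 * (4 * (2 * Real.sqrt 2 / s₁ + 2) ^ 2) + 16 * (1 / s₁ + 1) ^ 2) ≤
      32768 * (2 / s₀) * (4768 / s₁ ^ 2) := by
    have h1 : (1 + 4 * Real.sqrt 2) ^ 2 * (4 * (2 * Real.sqrt 2 / s₁ + 2) ^ 2) + 16 * (1 / s₁ + 1) ^ 2 ≤ 4768 / s₁ ^ 2 := by
      have h49 := one_add_four_sqrt_two_sq_le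
      have h4b : 4 * (2 * Real.sqrt 2 / s₁ + 2) ^ 2 ≤ 96 / s₁ ^ 2 := by
        have := mul_le_mul_of_nonneg_left hb2 (by norm_num : (0:ℝ) ≤ 4)
        refine this.trans (le_of_eq ?_); ring
      have h4b0 : 0 ≤ 4 * (2 * Real.sqrt 2 / s₁ + 2) ^ 2 := by positivity
      have hA : (1 + 4 * Real.sqrt 2) ^ 2 * (4 * (2 * Real.sqrt 2 / s₁ + 2) ^ 2) ≤ 49 * (96 / s₁ ^ 2) :=
        mul_le_mul h49 h4b h4b0 (by norm_num)
      have hB : 16 * (1 / s₁ + 1) ^ 2 ≤ 16 * (4 / s₁ ^ 2) := mul_le_mul_of_nonneg_left hc2 (by norm_num)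
      refine (add_le_add hA hB).trans (le_of_eq ?_)
      ring
    have h0 : 0 ≤ (1 + 4 * Real.sqrt 2) ^ 2 * (4 * (2 * Real.sqrt 2 / s₁ + 2) ^ 2) + 16 * (1 / s₁ + 1) ^ 2 := by positivity
    calc 32768 * (1 / s₀ + 1) * ((1 + 4 * Real.sqrt 2) ^ 2 * (4 * (2 * Real.sqrt 2 / s₁ + 2) ^ 2) + 16 * (1 / s₁ + 1) ^ 2)
        ≤ 32768 * (2 / s₀) * ((1 + 4 * Real.sqrt 2) ^ 2 * (4 * (2 * Real.sqrt 2 / s₁ + 2) ^ 2) + 16 * (1 / s₁ + 1) ^ 2) :=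
          mul_le_mul_of_nonneg_right (mul_le_mul_of_nonneg_left ha (by norm_num)) h0
      _ ≤ 32768 * (2 / s₀) * (4768 / s₁ ^ 2) := mul_le_mul_of_nonneg_left h1 (by positivity)
  have hN : 21 * P * (L : ℝ) ^ 2 * Ns ≤ 21 * P * (L : ℝ) ^ 2 * (n₀ * (s₀ * P) * (s₁ * L) ^ 2) :=
    mul_le_mul_of_nonneg_left hNs (by positivity)
  have hK0 : 0 ≤ 32768 * (1 / s₀ + 1) * ((1 + 4 * Real.sqrt 2) ^ 2 * (4 * (2 * Real.sqrt 2 / s₁ + 2) ^ 2) + 16 * (1 / s₁ + 1) ^ 2) := by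
    positivity
  have hN0 : 0 ≤ 21 * P * (L : ℝ) ^ 2 * Ns := by positivity
  calc _ ≤ 32768 * (2 / s₀) * (4768 / s₁ ^ 2) * (21 * P * (L : ℝ) ^ 2 * (n₀ * (s₀ * P) * (s₁ * L) ^ 2)) :=
        mul_le_mul hK hN hN0 (hK0.trans hK)
    _ = 6561988608 * n₀ * ((P : ℝ) * (L : ℝ) ^ 2) ^ 2 := by
        field_simp
        ring

/-- **A bump at any scale has normalised ONE-MOMENT weighted `ℓ¹` norm `O(1)` at every weight rate below its own**: under the hypotheses of
`sum_wt_norm_charSum_le_of_third_differences_axes` with rates `s₀, s₁ ∈ (0,1]`, a support count of bump type `N_s ≤ n₀·(s₀P)·(s₁L)²`, and weight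
rates `t₀ ≤ s₀`, `t₁ ≤ s₁`:
`Σ_z (1 + t₀|z̃₁| + t₁|z̃₂,₁| + t₁|z̃₂,₂|)·‖Σ_q χ_{q₁}(z₁)χ_{q₂}(z₂)•G(q)‖ ≤ √(6561988608·n₀)·(P·L²)·A₀` — no rate survives.
[cite: BenfattoGiulianiMastropietro2006, Lemma 2.2 (2.52), §2.8 (2.81) footnote 1] -/
theorem sum_wt_norm_charSum_bump_le (G : TorusSite 1 P × TorusSite 2 L → ℂ)
    {s₀ s₁ : ℝ} (hs₀ : 0 < s₀) (hs₀1 : s₀ ≤ 1) (hs₁ : 0 < s₁) (hs₁1 : s₁ ≤ 1) {t₀ t₁ : ℝ} (ht₀s : t₀ ≤ s₀)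
    (ht₁s : t₁ ≤ s₁) {A₀ : ℝ} (hA₀ : 0 ≤ A₀) {Ns : ℕ} {n₀ : ℝ}
    (hn₀ : 0 ≤ n₀) (hNs : (Ns : ℝ) ≤ n₀ * (s₀ * P) * (s₁ * L) ^ 2)
    (hsupp : (univ.filter fun q => G q ≠ 0).card ≤ Ns) (hsup : ∀ q, ‖G q‖ ≤ A₀)
    (h₀ : ∀ q, ‖(fwdDiff ((fun _ : Fin 1 => (1 : ZMod P)), (0 : TorusSite 2 L)))^[3] G q‖ ≤ A₀ * (4 / (s₀ * P)) ^ 3)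
    (h₁ : ∀ q (i : Fin 2), ‖(fwdDiff ((0 : TorusSite 1 P), (Pi.single i (1 : ZMod L) : TorusSite 2 L)))^[3] G q‖ ≤
      A₀ * (4 / (s₁ * L)) ^ 3) :
    ∑ z : TorusSite 1 P × TorusSite 2 L,
      (1 + t₀ * |(((z.1 0).valMinAbs : ℤ) : ℝ)| + t₁ * |(((z.2 0).valMinAbs : ℤ) : ℝ)| + t₁ * |(((z.2 1).valMinAbs : ℤ) : ℝ)|) *
        ‖∑ q : TorusSite 1 P × TorusSite 2 L, (torusChar q.1 z.1 * torusChar q.2 z.2) • G q‖ ≤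
      Real.sqrt (6561988608 * n₀) * ((P : ℝ) * (L : ℝ) ^ 2) * A₀ := by
  -- the weight at rates `(t₀, t₁)` is below the weight at the bump's own rates
  have hmono : ∑ z : TorusSite 1 P × TorusSite 2 L,
      (1 + t₀ * |(((z.1 0).valMinAbs : ℤ) : ℝ)| + t₁ * |(((z.2 0).valMinAbs : ℤ) : ℝ)| + t₁ * |(((z.2 1).valMinAbs : ℤ) : ℝ)|) *
        ‖∑ q : TorusSite 1 P × TorusSite 2 L, (torusChar q.1 z.1 * torusChar q.2 z.2) • G q‖ ≤
      ∑ z : TorusSite 1 P × TorusSite 2 L,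
      (1 + s₀ * |(((z.1 0).valMinAbs : ℤ) : ℝ)| + s₁ * |(((z.2 0).valMinAbs : ℤ) : ℝ)| + s₁ * |(((z.2 1).valMinAbs : ℤ) : ℝ)|) *
        ‖∑ q : TorusSite 1 P × TorusSite 2 L, (torusChar q.1 z.1 * torusChar q.2 z.2) • G q‖ :=
    sum_le_sum fun z _ => mul_le_mul_of_nonneg_right (momentWt_mono ht₀s ht₁s z) (norm_nonneg _)
  refine hmono.trans ((sum_wt_norm_charSum_le_of_third_differences_axes G hs₀ hs₁ hA₀ hsupp hsup h₀ h₁).trans ?_)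
  have hPL : 0 ≤ (P : ℝ) * (L : ℝ) ^ 2 := by positivity
  have hK0 : 0 ≤ 32768 * (1 / s₀ + 1) *
      ((1 + 4 * Real.sqrt 2) ^ 2 * (4 * (2 * Real.sqrt 2 / s₁ + 2) ^ 2) + 16 * (1 / s₁ + 1) ^ 2) := by positivity
  have hkey : Real.sqrt (32768 * (1 / s₀ + 1) *
        ((1 + 4 * Real.sqrt 2) ^ 2 * (4 * (2 * Real.sqrt 2 / s₁ + 2) ^ 2) + 16 * (1 / s₁ + 1) ^ 2)) *
      Real.sqrt (21 * P * (L : ℝ) ^ 2 * Ns) ≤ Real.sqrt (6561988608 * n₀) * ((P : ℝ) * (L : ℝ) ^ 2) := by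
    have h1 : Real.sqrt (6561988608 * n₀) * ((P : ℝ) * (L : ℝ) ^ 2) =
        Real.sqrt (6561988608 * n₀ * ((P : ℝ) * (L : ℝ) ^ 2) ^ 2) := by
      rw [Real.sqrt_mul (by positivity : (0 : ℝ) ≤ 6561988608 * n₀) (((P : ℝ) * (L : ℝ) ^ 2) ^ 2), Real.sqrt_sq hPL]
    rw [← Real.sqrt_mul hK0, h1]
    exact Real.sqrt_le_sqrt (rate_bookkeeping_wt_le hs₀ hs₀1 hs₁ hs₁1 hNs)
  exact mul_le_mul_of_nonneg_right hkey hA₀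

/-! ### §4 Superpositions -/

/-- **Triangle inequality for weighted superpositions**: `Σ_z w(z)‖S[Σ_s a_s G_s](z)‖ ≤ Σ_s ‖a_s‖ · Σ_z w(z)‖S[G_s](z)‖` for a nonnegative weight `w`. [folklore] -/
theorem sum_wt_norm_charSum_sum_mul_le {ι : Type*} (S : Finset ι) (a : ι → ℂ) (G : ι → TorusSite 1 P × TorusSite 2 L → ℂ)
    (w : TorusSite 1 P × TorusSite 2 L → ℝ) (hw : ∀ z, 0 ≤ w z) :
    ∑ z : TorusSite 1 P × TorusSite 2 L,
        w z * ‖∑ q : TorusSite 1 P × TorusSite 2 L, (torusChar q.1 z.1 * torusChar q.2 z.2) • (∑ s ∈ S, a s * G s q)‖ ≤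
      ∑ s ∈ S, ‖a s‖ * ∑ z : TorusSite 1 P × TorusSite 2 L,
        w z * ‖∑ q : TorusSite 1 P × TorusSite 2 L, (torusChar q.1 z.1 * torusChar q.2 z.2) • G s q‖ := by
  calc _ = ∑ z : TorusSite 1 P × TorusSite 2 L,
        w z * ‖∑ s ∈ S, a s * ∑ q : TorusSite 1 P × TorusSite 2 L, (torusChar q.1 z.1 * torusChar q.2 z.2) • G s q‖ := by
          refine sum_congr rfl fun z _ => ?_; rw [charSum_sum_mul_eq]
    _ ≤ ∑ z : TorusSite 1 P × TorusSite 2 L,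
        w z * ∑ s ∈ S, ‖a s‖ * ‖∑ q : TorusSite 1 P × TorusSite 2 L, (torusChar q.1 z.1 * torusChar q.2 z.2) • G s q‖ := by
          refine sum_le_sum fun z _ => mul_le_mul_of_nonneg_left ((norm_sum_le _ _).trans (le_of_eq ?_)) (hw z)
          exact sum_congr rfl fun s _ => norm_mul _ _
    _ = _ := by
          simp_rw [mul_sum]
          rw [sum_comm]
          exact sum_congr rfl fun s _ => sum_congr rfl fun z _ => by ring

/-- **The one-moment weighted `ℓ¹` norm of a superposition of scale bumps is paid by the `ℓ¹` sum of its coefficients**: for a finite family `G_s` of bumps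
with rates `(s₀ˢ, s₁ˢ)`, `t₀ ≤ s₀ˢ ≤ 1`, `t₁ ≤ s₁ˢ ≤ 1` (every bump FINER than the weight), sizes `A_s ≥ 0`, supports `≤ n₀·s₀ˢP·(s₁ˢL)²`, coefficients `a_s`:
`Σ_z (1 + t₀|z̃₁| + t₁|z̃₂,₁| + t₁|z̃₂,₂|)·‖S[Σ_s a_s G_s](z)‖ ≤ √(6561988608·n₀)·(P·L²)·Σ_s ‖a_s‖·A_s`.
[cite: BenfattoGiulianiMastropietro2006, Lemma 2.2 (2.52), §2.8 (2.81) footnote 1] -/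
theorem sum_wt_norm_charSum_superposition_le {ι : Type*} (S : Finset ι) (a : ι → ℂ) (G : ι → TorusSite 1 P × TorusSite 2 L → ℂ)
    (s₀ s₁ A : ι → ℝ) (Ns : ι → ℕ) {n₀ : ℝ} (hn₀ : 0 ≤ n₀) {t₀ t₁ : ℝ} (ht₀ : 0 ≤ t₀) (ht₁ : 0 ≤ t₁)
    (hs₀ : ∀ s ∈ S, t₀ ≤ s₀ s) (hs₀p : ∀ s ∈ S, 0 < s₀ s) (hs₀1 : ∀ s ∈ S, s₀ s ≤ 1)
    (hs₁ : ∀ s ∈ S, t₁ ≤ s₁ s) (hs₁p : ∀ s ∈ S, 0 < s₁ s) (hs₁1 : ∀ s ∈ S, s₁ s ≤ 1)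
    (hA : ∀ s ∈ S, 0 ≤ A s) (hNs : ∀ s ∈ S, (Ns s : ℝ) ≤ n₀ * (s₀ s * P) * (s₁ s * L) ^ 2)
    (hsupp : ∀ s ∈ S, (univ.filter fun q => G s q ≠ 0).card ≤ Ns s) (hsup : ∀ s ∈ S, ∀ q, ‖G s q‖ ≤ A s)
    (h₀ : ∀ s ∈ S, ∀ q, ‖(fwdDiff ((fun _ : Fin 1 => (1 : ZMod P)), (0 : TorusSite 2 L)))^[3] (G s) q‖ ≤ A s * (4 / (s₀ s * P)) ^ 3)
    (h₁ : ∀ s ∈ S, ∀ q (i : Fin 2), ‖(fwdDiff ((0 : TorusSite 1 P), (Pi.single i (1 : ZMod L) : TorusSite 2 L)))^[3] (G s) q‖ ≤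
      A s * (4 / (s₁ s * L)) ^ 3) :
    ∑ z : TorusSite 1 P × TorusSite 2 L,
        (1 + t₀ * |(((z.1 0).valMinAbs : ℤ) : ℝ)| + t₁ * |(((z.2 0).valMinAbs : ℤ) : ℝ)| + t₁ * |(((z.2 1).valMinAbs : ℤ) : ℝ)|) *
        ‖∑ q : TorusSite 1 P × TorusSite 2 L, (torusChar q.1 z.1 * torusChar q.2 z.2) • (∑ s ∈ S, a s * G s q)‖ ≤
      Real.sqrt (6561988608 * n₀) * ((P : ℝ) * (L : ℝ) ^ 2) * ∑ s ∈ S, ‖a s‖ * A s := by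
  refine (sum_wt_norm_charSum_sum_mul_le S a G _ (fun z => by positivity)).trans ?_
  rw [mul_sum]
  refine sum_le_sum fun s hs => ?_
  have hb := sum_wt_norm_charSum_bump_le (G s) (hs₀p s hs) (hs₀1 s hs) (hs₁p s hs) (hs₁1 s hs) (hs₀ s hs) (hs₁ s hs)
    (hA s hs) hn₀ (hNs s hs) (hsupp s hs) (hsup s hs) (h₀ s hs) (h₁ s hs)
  calc ‖a s‖ * ∑ z : TorusSite 1 P × TorusSite 2 L,
        (1 + t₀ * |(((z.1 0).valMinAbs : ℤ) : ℝ)| + t₁ * |(((z.2 0).valMinAbs : ℤ) : ℝ)| + t₁ * |(((z.2 1).valMinAbs : ℤ) : ℝ)|) *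
          ‖∑ q, (torusChar q.1 z.1 * torusChar q.2 z.2) • G s q‖
      ≤ ‖a s‖ * (Real.sqrt (6561988608 * n₀) * ((P : ℝ) * (L : ℝ) ^ 2) * A s) := mul_le_mul_of_nonneg_left hb (norm_nonneg _)
    _ = Real.sqrt (6561988608 * n₀) * ((P : ℝ) * (L : ℝ) ^ 2) * (‖a s‖ * A s) := by ring

end Summit.HubbardSuperconductivity.HubbardSuperconductivity.Theorems.TorusFourierL2

end
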